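import Summits.QuantumFields.YangMills.Theorems.UnitScaleTiltProp7DivRecoveryAssemblyBudget
import Summits.QuantumFields.YangMills.Theorems.UnitScaleTiltProp7DivRecoveryForm
import Summits.QuantumFields.YangMills.Theorems.UnitScaleTiltProp7SectET3CombLettersT3
import HarnessLib

/-!
# Prop. 7 on T³ — lane II (B7-ROWS⟹COLL) v2: the collected row from the per-member patch rows, WITH A PATCH-EXPONENT FLOOR `s₀`

Route `UnitScaleTilt`, crux `MinimiserStabilityRegPr` (stmt-QuantumFields-19200), E′ growth side, lane II «divergence recovery at the curved regular member».
(E1) of the PATCHES2 assembler (ym3-torus-px12 g9): ✓`Prop7DivRecoveryCollectedOfRows.hColl_of_rows` quantifies the patch exponent over ALL `s : ℕ`, but its only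
consumer ✓`Prop7DivRecoveryOfCollected.hRec_of_collected` uses ONE large `s` (`A₃·L^{−2s} ≤ δ`), while the lane-II bricks need room in the patch (`2 ≤ L^s` for the
chart, `4 ≤ L^s` for the peeled box of NAMER WORD №16).  This sibling states the SAME implication with `∃ s₀ : ℕ,` after the `s`-free constants and `s₀ ≤ s →` after `∀ s : ℕ,` on BOTH sides (prefixes
byte-identical to v1 up to the last `s`-free constant; px4 g9's drafting note);
the proof is ✓`hColl_of_rows`' bookkeeping verbatim under the extra binder.  The landed file is untouched.

HONEST SCOPE.  Bookkeeping; `hRows` (v2) is OPEN; nothing of (REC)∕hN06∕hcoS∕E′∕EX∕the crux is proved here; YM₃ on T³ is rung R3 — NOT d = 4, NOT infinite volume,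
NOT a mass gap, NOT Clay.
[cite: Balaban1985BackgroundPropagators, (3.10) p.392, (3.20)-(3.26) pp.394-395]
-/

set_option autoImplicit false

noncomputable section

open scoped InnerProductSpace ComplexConjugate BigOperators Matrix.Norms.L2Operator

namespace Summit.QuantumFields.YangMills.Theorems.Prop7DivRecoveryCollectedOfRowsV2

open Literature.MathematicalPhysics.QuantumFieldTheory.Balaban1983to89
open Literature.MathematicalPhysics.QuantumFieldTheory.Balaban1983to89.T3ContinuumYM3Torus
open T3PrintedRegularMinimiser (RegPr)
open B11Eq103H1Complex (SiteL2K BondL2K)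
open Summit.QuantumFields.YangMills.Theorems.Prop7SectET3Transport (periodsT3)
open Summit.QuantumFields.YangMills.Theorems.Prop7SectET3HilbertLetters (W₂ DL2 DstarL2)
open Summit.QuantumFields.YangMills.Theorems.Prop7SectET3WilsonHessian (DeltaEtaSlot)
open Summit.QuantumFields.YangMills.Theorems.Prop7SectET3CombLetters (Qkc)
open Summit.QuantumFields.YangMills.Theorems.Prop7QprimeCombL2 (RcombL2)
open Summit.QuantumFields.YangMills.Theorems.Prop7DivRecoveryAssemblyBudget (summed_budget)

variable (c₀ cB a₀ : ℕ → ℝ) [hc₀ : ∀ L : ℕ, Fact (0 < c₀ L)] [hcB : ∀ L : ℕ, Fact (0 < cB L)]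

/-- ★★★ **(B7-ROWS⟹COLL) v2 — with the floor `s₀ ≤ s` on both sides.**  `hRows`: for every `L > 1` a floor `s₀` and the `s`-free data `ν a₂ a₃ cL cMR cHM ≥ 0`, then for every patch exponent `s ≥ s₀` the remaining nonnegative
coefficients and a radius `0 < eC ≤ 1`, such that at every member with `s < F.m + n`, `0 < e ≤ eC`, `RegPr`, and every `y`, there are patch-indexed reals (index
`Site (F.P K) 0`, the cutoff centres of ✓`exists_cutoffPackage`) `N Cu As ρ Φ K L M Hρ HM` and seven global reals `Sr SM SHr SHM SL SK SΦ` with: the seven per-patch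
bounds (input shapes of ✓`summed_budget`, `R := L^s`), the three overlap sums against `‖y‖²`, `re⟪y,Δ^η y⟫ + 1029e‖y‖²`, `(c₀∕cB)ℓ³‖Qkc y‖²`, the five family-sum rows, and
the (B7-MEMBER-CORE) row for `G := ‖D*y − R(D*y)‖²`.  Conclusion: `hColl` of ✓`hRec_of_collected` with the same floor (`A₃ := a₂ν²cMR + a₃ν²cHM + 3ν²cL`), consumed by `Prop7DivRecoveryOfCollectedV2.hRec_of_collected_v2`.
[cite: Balaban1985BackgroundPropagators, (3.10) p.392, (3.20)-(3.26) pp.394-395] -/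
theorem hColl_of_rows_v2 (ha₀ : ∀ L, 1 < L → 0 < a₀ L)
    (hRows : ∀ (L : ℕ), 1 < L → ∃ ν a₂ a₃ cL cMR cHM : ℝ, 0 ≤ ν ∧ 0 ≤ a₂ ∧ 0 ≤ a₃ ∧ 0 ≤ cL ∧ 0 ≤ cMR ∧ 0 ≤ cHM ∧
      ∃ s₀ : ℕ, ∀ s : ℕ, s₀ ≤ s → ∃ a₁ a₄ cΦ cρCu cρN cKCu cKN cMAs cMCu cMe cHCu cHN eC : ℝ,
        0 ≤ a₁ ∧ 0 ≤ a₄ ∧ 0 ≤ cΦ ∧ 0 ≤ cρCu ∧ 0 ≤ cρN ∧ 0 ≤ cKCu ∧ 0 ≤ cKN ∧ 0 ≤ cMAs ∧ 0 ≤ cMCu ∧ 0 ≤ cMe ∧ 0 ≤ cHCu ∧ 0 ≤ cHN ∧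
        0 < eC ∧ eC ≤ 1 ∧
        ∀ (F : T3Family), F.L = L → ∀ (n K : ℕ) (hnK : n < K) (e : ℝ) (W : GaugeField (F.P K) 0 (Matrix.specialUnitaryGroup (Fin 2) ℂ)),
          s < F.m + n → 0 < e → e ≤ eC → RegPr F n K e W →
          ∀ y : BondL2K ℂ 3 (periodsT3 F K) (c₀ F.L) W₂,
            ∃ (Ni Cui Asi ρi Φi Ki Li Mi Hρi HMi : Site (F.P K) 0 → ℝ) (Sr SM SHr SHM SL SK SΦ : ℝ),
              (∀ i, Φi i ≤ cΦ * ((F.L : ℝ) ^ s) ^ 2 * Ni i) ∧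
              (∀ i, ρi i ≤ cρCu * Cui i + cρN * e * Ni i) ∧
              (∀ i, Ki i ≤ cKCu * Cui i + cKN * e * Ni i) ∧
              (∀ i, Li i ≤ cL * ((F.L : ℝ) ^ s)⁻¹ ^ 2 * Ni i) ∧
              (∀ i, Mi i ≤ cMAs * Asi i + cMCu * Cui i + (cMR * ((F.L : ℝ) ^ s)⁻¹ ^ 2 + cMe * e) * Ni i) ∧
              (∀ i, Hρi i ≤ cHCu * Cui i + cHN * e * Ni i) ∧
              (∀ i, HMi i ≤ cHM * ((F.L : ℝ) ^ s)⁻¹ ^ 2 * Ni i) ∧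
              (∑ i, Ni i ≤ ν * ‖y‖ ^ 2) ∧
              (∑ i, Cui i ≤ ν * (RCLike.re ⟪y, DeltaEtaSlot F n K (c₀ F.L) W y⟫_ℂ + 1029 * e * ‖y‖ ^ 2)) ∧
              (∑ i, Asi i ≤ ν * ((c₀ F.L / cB F.L) * ((F.L : ℝ) ^ (K - n)) ^ 3 * ‖Qkc F n K hnK.le (c₀ F.L) (cB F.L) W y‖ ^ 2)) ∧
              (Sr ≤ ν * ∑ i, ρi i) ∧ (SM ≤ ν * ∑ i, Mi i) ∧ (SHr ≤ ν * ∑ i, Hρi i) ∧ (SHM ≤ ν * ∑ i, HMi i) ∧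
              (SL ≤ ν * ∑ i, Li i) ∧ (SK ≤ ν * ∑ i, Ki i) ∧ (0 ≤ SΦ) ∧ (SΦ ≤ ν * ∑ i, Φi i) ∧
              ‖DstarL2 F n K (c₀ F.L) W y - RcombL2 F n K (c₀ F.L) W (DstarL2 F n K (c₀ F.L) W y)‖ ^ 2
                ≤ a₁ * ((c₀ F.L / cB F.L) * ((F.L : ℝ) ^ (K - n)) ^ 3 * ‖Qkc F n K hnK.le (c₀ F.L) (cB F.L) W y‖ ^ 2)
                  + a₂ * (Sr + SM) + a₃ * (SHr + SHM) + a₄ * e ^ 2 * SΦ + 3 * SL + 3 * SK) :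
    ∀ (L : ℕ), 1 < L → ∃ A₃ : ℝ, 0 ≤ A₃ ∧ ∃ s₀ : ℕ, ∀ s : ℕ, s₀ ≤ s → ∃ A₁ A₂ A₄ eC : ℝ, 0 ≤ A₁ ∧ 0 ≤ A₂ ∧ 0 ≤ A₄ ∧ 0 < eC ∧
      ∀ (F : T3Family), F.L = L → ∀ (n K : ℕ) (hnK : n < K) (e : ℝ) (W : GaugeField (F.P K) 0 (Matrix.specialUnitaryGroup (Fin 2) ℂ)),
        s < F.m + n → 0 < e → e ≤ eC → RegPr F n K e W →
        ∀ y : BondL2K ℂ 3 (periodsT3 F K) (c₀ F.L) W₂,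
          ‖DstarL2 F n K (c₀ F.L) W y - RcombL2 F n K (c₀ F.L) W (DstarL2 F n K (c₀ F.L) W y)‖ ^ 2
            ≤ A₁ * ((a₀ F.L * (c₀ F.L / cB F.L) * ((F.L : ℝ) ^ (K - n)) ^ 3) * ‖Qkc F n K hnK.le (c₀ F.L) (cB F.L) W y‖ ^ 2)
              + A₂ * (RCLike.re ⟪y, DeltaEtaSlot F n K (c₀ F.L) W y⟫_ℂ + 1029 * e * ‖y‖ ^ 2)
              + (A₃ * ((F.L : ℝ) ^ s)⁻¹ ^ 2 + A₄ * e) * ‖y‖ ^ 2 := by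
  intro L hL
  obtain ⟨ν, a₂, a₃, cL, cMR, cHM, hν, ha₂, ha₃, hcL, hcMR, hcHM, s₀, hs⟩ := hRows L hL
  have ha : 0 < a₀ L := ha₀ L hL
  refine ⟨a₂ * ν ^ 2 * cMR + a₃ * ν ^ 2 * cHM + 3 * ν ^ 2 * cL, by positivity, s₀, fun s hs₀ => ?_⟩
  obtain ⟨a₁, a₄, cΦ, cρCu, cρN, cKCu, cKN, cMAs, cMCu, cMe, cHCu, cHN, eC,
    ha₁, ha₄, hcΦ, hcρCu, hcρN, hcKCu, hcKN, hcMAs, hcMCu, hcMe, hcHCu, hcHN, heC, heC1, hmem⟩ := hs s hs₀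
  refine ⟨(a₁ + a₂ * ν ^ 2 * cMAs) / a₀ L,
    a₂ * ν ^ 2 * (cρCu + cMCu) + a₃ * ν ^ 2 * cHCu + 3 * ν ^ 2 * cKCu,
    a₂ * ν ^ 2 * (cρN + cMe) + a₃ * ν ^ 2 * cHN + a₄ * ν ^ 2 * cΦ * ((L : ℝ) ^ s) ^ 2 + 3 * ν ^ 2 * cKN,
    eC, by positivity, by positivity, by positivity, heC, ?_⟩
  intro F hF n K hnK e W hsm he heC' hreg y
  obtain ⟨Ni, Cui, Asi, ρi, Φi, Ki, Li, Mi, Hρi, HMi, Sr, SM, SHr, SHM, SL, SK, SΦ,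
    hΦ, hρ, hK, hLi, hM, hHρ, hHM, hsumN, hsumCu, hsumAs, hSr, hSM, hSHr, hSHM, hSL, hSK, hSΦ0, hSΦ, hcore⟩ :=
    hmem F hF n K hnK e W hsm he heC' hreg y
  subst hF
  have he1 : e ≤ 1 := heC'.trans heC1
  -- the budget
  have h := summed_budget (ι := Site (F.P K) 0) (N := ‖y‖ ^ 2)
    (Cplus := RCLike.re ⟪y, DeltaEtaSlot F n K (c₀ F.L) W y⟫_ℂ + 1029 * e * ‖y‖ ^ 2)
    (AVG := (c₀ F.L / cB F.L) * ((F.L : ℝ) ^ (K - n)) ^ 3 * ‖Qkc F n K hnK.le (c₀ F.L) (cB F.L) W y‖ ^ 2)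
    (G := ‖DstarL2 F n K (c₀ F.L) W y - RcombL2 F n K (c₀ F.L) W (DstarL2 F n K (c₀ F.L) W y)‖ ^ 2)
    (R := (F.L : ℝ) ^ s) (a₁ := a₁)
    Ni Cui Asi ρi Φi Ki Li Mi Hρi HMi he.le he1 hν ha₂ ha₃ ha₄ hcΦ hcρCu hcρN hcKCu hcKN hcL hcMAs hcMCu hcMR hcMe hcHCu hcHN hcHM
    hΦ hρ hK hLi hM hHρ hHM hsumN hsumCu hsumAs hSr hSM hSHr hSHM hSL hSK hSΦ0 hSΦ hcore
  -- the AVG currency: `X·AVGres = (X∕a₀)·(a₀·AVGres)`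
  have hAVG : (a₁ + a₂ * ν ^ 2 * cMAs) * ((c₀ F.L / cB F.L) * ((F.L : ℝ) ^ (K - n)) ^ 3 * ‖Qkc F n K hnK.le (c₀ F.L) (cB F.L) W y‖ ^ 2)
      = (a₁ + a₂ * ν ^ 2 * cMAs) / a₀ F.L
          * ((a₀ F.L * (c₀ F.L / cB F.L) * ((F.L : ℝ) ^ (K - n)) ^ 3) * ‖Qkc F n K hnK.le (c₀ F.L) (cB F.L) W y‖ ^ 2) := by
    field_simp
  rw [hAVG] at h
  have hid : (a₂ * ν ^ 2 * cMR + a₃ * ν ^ 2 * cHM + 3 * ν ^ 2 * cL) * ((F.L : ℝ) ^ s)⁻¹ ^ 2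
      + (a₂ * ν ^ 2 * (cρN + cMe) + a₃ * ν ^ 2 * cHN + a₄ * ν ^ 2 * cΦ * ((F.L : ℝ) ^ s) ^ 2 + 3 * ν ^ 2 * cKN) * e
      = (a₂ * ν ^ 2 * cMR + a₃ * ν ^ 2 * cHM + 3 * ν ^ 2 * cL) * ((F.L : ℝ) ^ s)⁻¹ ^ 2
      + (a₂ * ν ^ 2 * (cρN + cMe) + a₃ * ν ^ 2 * cHN + a₄ * ν ^ 2 * cΦ * ((F.L : ℝ) ^ s) ^ 2 + 3 * ν ^ 2 * cKN) * e := rfl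
  linarith

end Summit.QuantumFields.YangMills.Theorems.Prop7DivRecoveryCollectedOfRowsV2

end
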